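import Summits.BirchSwinnertonDyer.Rank1Residual.AdditivePotMult.TwistSupplyX4
import Summits.BirchSwinnertonDyer.Rank1Residual.AdditivePotMult.PStarTwistModel
import Summits.BirchSwinnertonDyer.Rank1Residual.Additive.TwistRamTransport
import HarnessLib

/-!
# The rank-zero `p`-multiplicative twist over a quadratic field with ODD discriminant prime to the
# other additive primes — the twist supply in the shape the Milne-free descent consumes
# (row T-MIL-UNI, FILE U-3; seat n1011-p01 GEN 10)

HONEST FRAMING (cell `b2b-bsdres`, run/shared/lean/b2b/bsd-rank1-residual/, verbatim in every
file): the goal of the cell is to DELETE the COMBINATION-SHAPED residual classes of the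
Birch–Swinnerton-Dyer formula for ALL analytic-rank `≤ 1` elliptic curves over `ℚ` — "full BSD
formula for every rank `≤ 1` curve in class `C`" assembled STRICTLY from published theorems — so
that the rank-`≤ 1` remainder becomes exactly the CONSTRUCTION-SHAPED classes, which are TYPED
(missing-input `Prop`s), NOT attempted. This is not "finishing BSD". Sub-classes X3♯(M) / X4(M)
(additive, potentially multiplicative prime; base-change-and-descend): a RESEARCH ROUTE; they stay
CONSTRUCTION-SHAPED; nothing is booked by this file; no mark / label moved. THEOREMS ONLY: no
definition, no named fact, no `sorry`.

## What (row T-MIL-UNI, `cells/n1011/skel/T-MIL-UNI.md` §0 (d), FILE U-3)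

additive-p1's `TwistSupplyX4.exists_rankZero_mult_twist_of_mult_twist` produces, for a pair `(E,p)`
potentially multiplicative at the odd prime `p`, a quadratic field `K` and a globally minimal model
`W_d` of `E^{(d_K)}` with `Mult W_d p`, `r_an(W_d) = 0` (Hoffstein–Luo 1997 + the twist root number,
tree `exists_twist_L_ne_zero_of_sign`). The Milne-free descent of FILE U-2 needs MORE of the field:
`d_K` ODD squarefree and every additive prime `ℓ ≠ p` of `E` prime to `d_K` (H-4b's population).
This file runs the same supply with the canonical parameter: `V` a globally minimal model of
`E^{(p*)}` (`PotMult.exists_mult_pStar_twist_model`, multiplicative at `p`), `S` = the primes of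
`N_E`, `n ≡ 1 (mod 8)` square-free positive with `p ∤ n`, `(n/ℓ) = 1` on `S`, `L(V^{(n)}, 1) ≠ 0`;
`K = ℚ(√(p*·n))`: **`d_K = p*·n ≡ 1 (mod 4)` is odd squarefree, `p ∥ d_K`, every additive `ℓ ≠ p`
of `E` is prime to `d_K`** (`ℓ ∣ N_E ⇒ (n/ℓ) = 1 ⇒ ℓ ∤ n`; `2 ∤ n`), `E^{(d_K)} ≅ V^{(n)}` is
multiplicative at `p` of analytic rank `0`, and (ram) transports from `E` to it (additive-p4's
`ram_of_twist_pStar` to `V`, then along the `q`-adic square `n`, x11b's `mult_iff_of_twist` /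
`padicValInt_minimalDiscriminantInt_eq_of_twist`, exactly as in additive-p1's supply).

* `PotMult.exists_rankZero_mult_twist_oddDiscr` — the data (`K`, `W_d`, `C_d`) with all clauses;
* `localHyp_of_oddDiscr` — H-4b's population hypothesis `hS` for `(W, K, W_d)` from those clauses;
* `ClassX4M.exists_rankZero_mult_twist_oddDiscr` — the X4(M) reading (`Irr W_d p`, `Ram W p → Ram
  W_d p`, `hS`), consumed by FILE U-4.

HONEST LIMITS: existence only (no bound on `d_K`); `p` odd; named-fact binders `hnf` (modularity:
newform) and `hHL` (Hoffstein–Luo 1997) displayed exactly as in additive-p1's supply; closes no class;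
moves no mark; 0 facts.

References: J. Hoffstein, W. Luo, Math. Res. Lett. 4 (1997) Theorem [HoffsteinLuo1997];
M. R. Murty, V. K. Murty, *Non-vanishing of L-functions and applications* Ch. 6 §1 [MurtyMurty1997];
J. H. Silverman, *ATAEC* V.5.3, IV.9.4 [SilvermanATAEC1994]; D. A. Marcus, *Number Fields* Ch. 2
Thm. 1 [Marcus1977].
-/

noncomputable section

open scoped Classical

open WeierstrassCurve Literature.NumberTheory.EllipticCurves
  Literature.NumberTheory.EllipticCurves.ModularForms
  Literature.NumberTheory.EllipticCurves.Rank1Residual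
  Literature.NumberTheory.EllipticCurves.Rank1Residual.Typed
  IsDedekindDomain Rat.HeightOneSpectrum NumberField
  Summit.BirchSwinnertonDyer.Rank1Residual.Additive

namespace Summit.BirchSwinnertonDyer.Rank1Residual.AdditivePotMult

section Supply

variable {W : WeierstrassCurve ℚ} [W.IsElliptic] {p : ℕ} [hp : Fact p.Prime]

/-! ### §1 Arithmetic of `p* = (−1)^{(p−1)/2} p` -/

/-- `p* = ±p` and `p* ≡ 1 (mod 4)` for an odd prime `p`, as an integer. [folklore] -/
theorem pStar_int_eq_or_and_emod_four (hp2 : p ≠ 2) :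
    (((-1 : ℤ) ^ (p / 2) * p = p) ∨ ((-1 : ℤ) ^ (p / 2) * p = -p)) ∧
      ((-1 : ℤ) ^ (p / 2) * p) % 4 = 1 := by
  have hodd : p % 2 = 1 := Nat.odd_iff.mp (hp.out.odd_of_ne_two hp2)
  rcases Nat.even_or_odd (p / 2) with he | ho
  · have h1 : (-1 : ℤ) ^ (p / 2) = 1 := he.neg_one_pow
    obtain ⟨k, hk⟩ := he
    refine ⟨Or.inl (by rw [h1, one_mul]), ?_⟩
    rw [h1, one_mul]
    omega
  · have h1 : (-1 : ℤ) ^ (p / 2) = -1 := ho.neg_one_pow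
    obtain ⟨k, hk⟩ := ho
    refine ⟨Or.inr (by rw [h1]; ring), ?_⟩
    rw [h1]
    omega

/-! ### §2 The supply -/

/-- **THE SUPPLY CORE, from a given `p*`-twist model and with a prescribed sign.** `W/ℚ` globally
minimal, `p` odd, `V` globally minimal MULTIPLICATIVE at `p` with `C • V^{(p*)} = W`
(`p* = (−1)^{(p−1)/2} p`), `s = ±1`; assuming modularity (`hnf`) and Hoffstein–Luo 1997 (`hHL`):
there are a square-free `n ≡ 1 (mod 8)` with `sign n = s`, `p ∤ n`, a quadratic field `K` with
`d_K = p*·n` (ODD, squarefree, `p ∣ d_K`), a globally minimal model `W_d = C₂ • V^{(n)}` of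
`E^{(d_K)}` (`C_d • W^{(d_K)} = W_d`), multiplicative at `p`, of analytic rank `0`, such that every
additive place `ℓ ≠ p` of `W` is prime to `d_K` and `Ram W p → Ram W_d p`. Construction: the twist
supply `exists_twist_L_ne_zero_of_sign` on `V` split at the primes of `N_W`; `ℓ ∣ N_W ⇒ (n/ℓ) = 1
⇒ ℓ ∤ n`; (ram): additive-p4's `ram_of_twist_pStar` to `V`, then along the `q`-adic square `n`
(x11b's `mult_iff_of_twist`, `padicValInt_minimalDiscriminantInt_eq_of_twist`).
[cite: HoffsteinLuo1997, Theorem (§1, pp. 435–436)] [cite: SilvermanATAEC1994, V.5.3 and IV.9.4] -/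
theorem exists_rankZero_mult_twist_oddDiscr_of_pStar_model [W.IsGloballyMinimal]
    (hnf : exists_isNewformOf) (hHL : HoffsteinLuo1997_exists_twist_L_one_ne_zero) (hp2 : p ≠ 2)
    (V : WeierstrassCurve ℚ) [V.IsElliptic] [V.IsGloballyMinimal] (C : VariableChange ℚ)
    (hmultV : Mult V p) (hCV : C • V.quadraticTwist ((-1 : ℚ) ^ (p / 2) * p) = W)
    {s : ℤ} (hs : s = 1 ∨ s = -1) :
    ∃ (K : Type) (_ : Field K) (_ : NumberField K) (Wd : WeierstrassCurve ℚ) (_ : Wd.IsElliptic)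
      (_ : Wd.IsGloballyMinimal) (Cd C₂ : VariableChange ℚ) (n : ℤ), Module.finrank ℚ K = 2 ∧
      n.sign = s ∧ ¬ (p : ℤ) ∣ n ∧ C₂ • V.quadraticTwist ((n : ℤ) : ℚ) = Wd ∧
      Odd (NumberField.discr K) ∧ Squarefree (NumberField.discr K) ∧
      (p : ℤ) ∣ NumberField.discr K ∧
      Cd • W.quadraticTwist (NumberField.discr K : ℚ) = Wd ∧ Mult Wd p ∧ Wd.analyticRank = 0 ∧
      (∀ v : HeightOneSpectrum (𝓞 ℚ), W.HasAdditiveReductionAt v → (primesEquiv v : ℕ) ≠ p →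
        ¬ ((primesEquiv v : ℕ) : ℤ) ∣ NumberField.discr K) ∧
      (Ram W p → Ram Wd p) := by
  have hpP : p.Prime := hp.out
  -- `p* = ±p ≡ 1 (mod 4)`
  obtain ⟨hdp, hps4⟩ := pStar_int_eq_or_and_emod_four (p := p) hp2
  have hps0 : ((-1 : ℚ) ^ (p / 2) * p) ≠ 0 := pStar_ne_zero p
  -- `p*` as an integer and as a rational
  set psZ : ℤ := (-1 : ℤ) ^ (p / 2) * p with hpsZ
  set ps : ℚ := (-1 : ℚ) ^ (p / 2) * p with hps
  have hcast : ((psZ : ℤ) : ℚ) = ps := by rw [hpsZ, hps]; push_cast; rfl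
  have hdk : psZ = 4 * (psZ / 4) + 1 := by omega
  have hCV' : C • V.quadraticTwist ((psZ : ℤ) : ℚ) = W := by rw [hcast]; exact hCV
  -- the twist supply on `V`, split at the primes of `N_W`
  set N : ℕ := W.conductorNorm ℤ with hN
  have hN0 : N ≠ 0 := (W.conductorNorm_pos_holds).ne'
  have hpN : p ∣ V.conductorNorm ℤ := dvd_conductorNorm_of_mult V hmultV
  have hpN2 : ¬ p ^ 2 ∣ V.conductorNorm ℤ := not_sq_dvd_conductorNorm_of_mult' V hmultV
  obtain ⟨n, hnsf, hn8, -, hnsign, hpn, hjac, hL⟩ :=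
    exists_twist_L_ne_zero_of_sign hnf hHL V hpP hp2 hpN hpN2 N.primeFactors hs 0
  have hn0 : n ≠ 0 := by
    rintro rfl
    rcases hs with h | h <;> rw [h] at hnsign <;> simp at hnsign
  have hnQ : ((n : ℤ) : ℚ) ≠ 0 := by exact_mod_cast hn0
  haveI := V.isElliptic_quadraticTwist hnQ
  obtain ⟨Wd, iWd, iWdm, C₂, hC₂⟩ := exists_globallyMinimal_model_twist V hnQ
  have hC₂' : C₂⁻¹ • Wd = V.quadraticTwist ((n : ℤ) : ℚ) := by rw [← hC₂, inv_smul_smul]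
  have hmultd : Mult Wd p :=
    X2.hasMultiplicativeReductionAtPrime_of_smul_eq_quadraticTwist V Wd hC₂' p hp2 hpn hmultV
  have hr0 : Wd.analyticRank = 0 := by
    rw [← hC₂, analyticRank_smul]
    exact analyticRank_eq_zero_of_entireLFunction_one_ne_zero _ hL
  -- `W^{(p*·n)} ≅ V^{(p*²·n)} ≅ V^{(n)} ≅ W_d`
  set d : ℤ := psZ * n with hd
  have hdQ : ((d : ℤ) : ℚ) = ps * ((n : ℤ) : ℚ) := by rw [hd, Int.cast_mul, hcast]
  obtain ⟨C₆, hC₆⟩ := V.exists_variableChange_quadraticTwist_mul_sq ((n : ℤ) : ℚ) ps hps0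
  have hWtw : W.quadraticTwist ((d : ℤ) : ℚ) =
      ((⟨C.u, ((d : ℤ) : ℚ) * C.r, 0, 0⟩ : VariableChange ℚ) * C₆) •
        V.quadraticTwist ((n : ℤ) : ℚ) := by
    rw [mul_smul, hC₆, ← hCV, quadraticTwist_smul, quadraticTwist_quadraticTwist, hdQ]
    congr 2
    ring
  set Cd : VariableChange ℚ := C₂ * ((⟨C.u, ((d : ℤ) : ℚ) * C.r, 0, 0⟩ : VariableChange ℚ) * C₆)⁻¹
    with hCd
  have hCdW : Cd • W.quadraticTwist ((d : ℤ) : ℚ) = Wd := by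
    rw [hCd, hWtw, mul_smul, inv_smul_smul, hC₂]
  -- the field `K = ℚ(√d)`, `d = p*·n ≡ 1 (mod 4)` squarefree, `d ≠ 1`
  have hn4 : n % 4 = 1 := by omega
  have hd4 : d % 4 = 1 := by
    rw [hd, Int.mul_emod, hps4, hn4]; norm_num
  have hpn' : ¬ p ∣ n.natAbs := fun h => hpn (Int.natCast_dvd.mpr h)
  have hpsabs : psZ.natAbs = p := by
    rcases hdp with h | h
    · rw [h, Int.natAbs_natCast]
    · rw [h, Int.natAbs_neg, Int.natAbs_natCast]
  have hdsq : Squarefree d := by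
    rw [← Int.squarefree_natAbs, hd, Int.natAbs_mul, hpsabs,
      Nat.squarefree_mul (hpP.coprime_iff_not_dvd.mpr hpn')]
    exact ⟨hpP.prime.squarefree, Int.squarefree_natAbs.mpr hnsf⟩
  have hd1 : d ≠ 1 := by
    intro h1
    have habs : d.natAbs = p * n.natAbs := by rw [hd, Int.natAbs_mul, hpsabs]
    rw [h1, Int.natAbs_one] at habs
    have hn1 : 1 ≤ n.natAbs := Int.natAbs_pos.mpr hn0
    have hp3 : 2 ≤ p := hpP.two_le
    nlinarith
  obtain ⟨K, iF, iN, h2, hK⟩ :=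
    Literature.NumberTheory.QuadraticFields.Quadratic.exists_numberField_discr_eq
      (D := d) (Or.inl ⟨hd4, hdsq, hd1⟩)
  have hpdvd : (p : ℤ) ∣ d := by
    rw [hd]
    rcases hdp with h | h
    · exact Dvd.dvd.mul_right (by rw [h]) _
    · exact Dvd.dvd.mul_right (by rw [h]; exact dvd_neg.mpr dvd_rfl) _
  refine ⟨K, iF, iN, Wd, iWd, iWdm, Cd, C₂, n, h2, hnsign, hpn, hC₂, ?_, ?_, ?_, ?_, hmultd, hr0,
    ?_, ?_⟩
  · rw [hK]; exact Int.odd_iff.mpr (by omega)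
  · rw [hK]; exact hdsq
  · rw [hK]; exact hpdvd
  · rw [hK]; exact hCdW
  · -- additive places `ℓ ≠ p` of `W` are prime to `d = p*·n`
    intro v hadd hvp hdvd
    set ℓ : ℕ := (primesEquiv v : ℕ) with hℓ
    have hℓP : ℓ.Prime := (primesEquiv v).2
    have hℓZ : Prime (ℓ : ℤ) := Nat.prime_iff_prime_int.mp hℓP
    rw [hK, hd] at hdvd
    -- `ℓ ∤ p*`, so `ℓ ∣ n`
    have hℓps : ¬ (ℓ : ℤ) ∣ psZ := by
      intro h
      have h' : (ℓ : ℤ) ∣ (p : ℤ) := by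
        rcases hdp with h1 | h1
        · rwa [h1] at h
        · rw [h1] at h; exact dvd_neg.mp h
      exact hvp ((Nat.prime_dvd_prime_iff_eq hℓP hpP).mp (Int.natCast_dvd_natCast.mp h'))
    have hℓn : (ℓ : ℤ) ∣ n := (hℓZ.dvd_or_dvd hdvd).resolve_left hℓps
    -- `ℓ ∣ N_W` (additive ⇒ bad), hence `(n/ℓ) = 1` (`ℓ` odd) or `n ≡ 1 (mod 8)` (`ℓ = 2`): `ℓ ∤ n`
    by_cases hℓ2 : ℓ = 2
    · rw [hℓ2] at hℓn
      omega
    · haveI : Fact ℓ.Prime := ⟨hℓP⟩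
      have hbad : ¬ W.HasGoodReductionAtPrime ℓ := by
        intro hg
        have hg' : W.HasGoodReductionAt v :=
          (W.hasGoodReductionAtPrime_iff_hasGoodReductionAt_ringOfIntegers (v := v)).mp hg
        exact hadd.not_hasGoodReductionAt hg'
      have hℓN : ℓ ∣ N := (W.dvd_conductorNorm_iff_not_hasGoodReductionAtPrime ℓ).mpr hbad
      have hℓS : ℓ ∈ N.primeFactors := Nat.mem_primeFactors.mpr ⟨hℓP, hℓN, hN0⟩
      exact not_dvd_of_jacobiSym_eq_one hℓP (hjac ℓ hℓS hℓP hℓ2 hvp) hℓn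
  · -- (ram) transports: `W → V` (unramified at the witness, `p* ≡ 1 mod 4`), `V → W_d` (along `n`)
    intro hram
    obtain ⟨q, iq, hqp, hmultq, hvq⟩ := ram_of_twist_pStar p V hdk hdp C hCV' hram
    have hqP : q.Prime := iq.out
    -- `n` is a `q`-adic square: `q ∣ N_W` (multiplicative for `W` too), so `(n/q) = 1`, or `q = 2`
    have hmultWq : Mult W q := (mult_iff_of_twist_pStar p V hdk hdp C hCV' hqp).mpr hmultq
    have hqN : q ∣ N := dvd_conductorNorm_of_mult W hmultWq
    have hnsq : IsSquare ((((n : ℤ) : ℚ) : ℚ) : ℚ_[q]) := by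
      by_cases hq2 : q = 2
      · have h := Literature.NumberTheory.QuadraticForms.padic_isSquare_intCast_of_mod_eight
          (p := q) hq2 hn8
        simpa using h
      · have hnq : jacobiSym n q = 1 :=
          hjac q (Nat.mem_primeFactors.mpr ⟨hqP, hqN, hN0⟩) hqP hq2 hqp
        have h := padic_isSquare_of_jacobiSym_eq_one hq2 hnq
        simpa using h
    refine ⟨q, iq, hqp, (X11b.mult_iff_of_twist V hnQ hnsq Wd hC₂).mpr hmultq, ?_⟩
    rwa [X11b.padicValInt_minimalDiscriminantInt_eq_of_twist V hnQ hnsq Wd hC₂]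

/-- **THE RANK-ZERO `p`-MULTIPLICATIVE TWIST OVER A QUADRATIC FIELD WITH ODD DISCRIMINANT PRIME TO THE
OTHER ADDITIVE PRIMES.** For `W/ℚ` globally minimal, additive potentially multiplicative at the odd
prime `p` (`PotMult W p`), assuming modularity (`hnf`) and Hoffstein–Luo 1997 (`hHL`): there are a
quadratic field `K`, a globally minimal `W_d` and `C_d` with `C_d • W^{(d_K)} = W_d` such that
`d_K` is ODD and squarefree, `p ∣ d_K`, `W_d` is multiplicative at `p` of analytic rank `0`, every
additive place `ℓ ≠ p` of `W` is prime to `d_K`, and `Ram W p → Ram W_d p` — the core applied to the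
`p*`-twist model of `PotMult.exists_mult_pStar_twist_model` with sign `+1`.
[cite: HoffsteinLuo1997, Theorem (§1, pp. 435–436)] [cite: SilvermanATAEC1994, V.5.3 and IV.9.4] -/
theorem PotMult.exists_rankZero_mult_twist_oddDiscr [W.IsGloballyMinimal]
    (hnf : exists_isNewformOf) (hHL : HoffsteinLuo1997_exists_twist_L_one_ne_zero)
    (hpm : PotMult W p) (hp2 : p ≠ 2) :
    ∃ (K : Type) (_ : Field K) (_ : NumberField K) (Wd : WeierstrassCurve ℚ) (_ : Wd.IsElliptic)
      (_ : Wd.IsGloballyMinimal) (Cd : VariableChange ℚ), Module.finrank ℚ K = 2 ∧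
      Odd (NumberField.discr K) ∧ Squarefree (NumberField.discr K) ∧
      (p : ℤ) ∣ NumberField.discr K ∧
      Cd • W.quadraticTwist (NumberField.discr K : ℚ) = Wd ∧ Mult Wd p ∧ Wd.analyticRank = 0 ∧
      (∀ v : HeightOneSpectrum (𝓞 ℚ), W.HasAdditiveReductionAt v → (primesEquiv v : ℕ) ≠ p →
        ¬ ((primesEquiv v : ℕ) : ℤ) ∣ NumberField.discr K) ∧
      (Ram W p → Ram Wd p) := by
  obtain ⟨V, iV, iVm, C, hmultV, hCV⟩ := hpm.exists_mult_pStar_twist_model hp2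
  obtain ⟨K, iF, iN, Wd, iWd, iWdm, Cd, -, -, h2, -, -, -, hodd, hsq, hpd, hWd, hmult, hr0, hadd,
    hram⟩ :=
    exists_rankZero_mult_twist_oddDiscr_of_pStar_model (W := W) (p := p) hnf hHL hp2 V C hmultV hCV
      (s := 1) (Or.inl rfl)
  exact ⟨K, iF, iN, Wd, iWd, iWdm, Cd, h2, hodd, hsq, hpd, hWd, hmult, hr0, hadd, hram⟩

/-- **H-4b's population hypothesis from the supply clauses.** If `p ∣ d_K`, `W_d` is multiplicative at
`p`, and every additive place `ℓ ≠ p` of `W` is prime to `d_K`, then at every place `W` is good ∨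
multiplicative ∨ (`ℓ ∣ d_K` ∧ `W_d` multiplicative) ∨ (additive, `ℓ ∤ d_K`, `p = 3 → ℓ ≠ 3`)
(trichotomy at each place; at `ℓ = p` the third disjunct, `Mult Wd p` transported to the place by the
tree's `hasMultiplicativeReductionAtPrime_iff_hasMultiplicativeReductionAt_ringOfIntegers`).
[cite: SilvermanAEC2009, VII.5 Prop. 5.1] -/
theorem localHyp_of_oddDiscr {K : Type} [Field K] [NumberField K] (W Wd : WeierstrassCurve ℚ)
    [W.IsElliptic] [Wd.IsElliptic] (p : ℕ) [hp : Fact p.Prime]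
    (hpd : (p : ℤ) ∣ NumberField.discr K) (hmult : Mult Wd p)
    (hadd : ∀ v : HeightOneSpectrum (𝓞 ℚ), W.HasAdditiveReductionAt v → (primesEquiv v : ℕ) ≠ p →
      ¬ ((primesEquiv v : ℕ) : ℤ) ∣ NumberField.discr K) :
    ∀ v : HeightOneSpectrum (𝓞 ℚ), W.HasGoodReductionAt v ∨ W.HasMultiplicativeReductionAt v ∨
      (((primesEquiv v : ℕ) : ℤ) ∣ NumberField.discr K ∧ Wd.HasMultiplicativeReductionAt v) ∨
      (W.HasAdditiveReductionAt v ∧ ¬ ((primesEquiv v : ℕ) : ℤ) ∣ NumberField.discr K ∧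
        (p = 3 → (primesEquiv v : ℕ) ≠ 3)) := by
  intro v
  rcases W.hasGoodReductionAt_or_hasMultiplicativeReductionAt_or_hasAdditiveReductionAt v with
    h | h | h
  · exact Or.inl h
  · exact Or.inr (Or.inl h)
  · by_cases hv : (primesEquiv v : ℕ) = p
    · refine Or.inr (Or.inr (Or.inl ⟨by rw [hv]; exact hpd, ?_⟩))
      have hm : (haveI := Fact.mk (primesEquiv v).2
          Wd.HasMultiplicativeReductionAtPrime (primesEquiv v)) := by
        have h' : Wd.HasMultiplicativeReductionAtPrime p := hmult
        subst hv
        exact h'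
      exact (Wd.hasMultiplicativeReductionAtPrime_iff_hasMultiplicativeReductionAt_ringOfIntegers v).mp hm
    · exact Or.inr (Or.inr (Or.inr ⟨h, hadd v h hv, fun hp3 hv3 => hv (by rw [hv3, hp3])⟩))

/-- **X4(M): the odd-discriminant rank-zero `p`-multiplicative IRREDUCIBLE twist, with H-4b's
population and the (ram) transport** — the data FILE U-4 feeds to FILE U-2's model-free END.
[cite: HoffsteinLuo1997, Theorem (§1, pp. 435–436)] [cite: SilvermanATAEC1994, V.5.3 and IV.9.4] -/
theorem ClassX4M.exists_rankZero_mult_twist_oddDiscr [W.IsGloballyMinimal] (hX : ClassX4M W p)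
    (hnf : exists_isNewformOf) (hHL : HoffsteinLuo1997_exists_twist_L_one_ne_zero) :
    ∃ (K : Type) (_ : Field K) (_ : NumberField K) (Wd : WeierstrassCurve ℚ) (_ : Wd.IsElliptic)
      (_ : Wd.IsGloballyMinimal) (Cd : VariableChange ℚ), Module.finrank ℚ K = 2 ∧
      Odd (NumberField.discr K) ∧ Squarefree (NumberField.discr K) ∧
      (p : ℤ) ∣ NumberField.discr K ∧
      Cd • W.quadraticTwist (NumberField.discr K : ℚ) = Wd ∧ Mult Wd p ∧ Irr Wd p ∧
      Wd.analyticRank = 0 ∧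
      (∀ v : HeightOneSpectrum (𝓞 ℚ), W.HasGoodReductionAt v ∨ W.HasMultiplicativeReductionAt v ∨
        (((primesEquiv v : ℕ) : ℤ) ∣ NumberField.discr K ∧ Wd.HasMultiplicativeReductionAt v) ∨
        (W.HasAdditiveReductionAt v ∧ ¬ ((primesEquiv v : ℕ) : ℤ) ∣ NumberField.discr K ∧
          (p = 3 → (primesEquiv v : ℕ) ≠ 3))) ∧
      (Ram W p → Ram Wd p) := by
  obtain ⟨K, iF, iN, Wd, iWd, iWdm, Cd, h2, hodd, hsq, hpd, hWd, hmult, hr0, hadd, hram⟩ :=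
    (ClassX4M.potMult W p hX).exists_rankZero_mult_twist_oddDiscr hnf hHL hX.p_ne_two
  have hD : (NumberField.discr K : ℚ) ≠ 0 := by exact_mod_cast NumberField.discr_ne_zero K
  exact ⟨K, iF, iN, Wd, iWd, iWdm, Cd, h2, hodd, hsq, hpd, hWd, hmult,
    (irr_iff_of_model_twist hD ⟨Cd, hWd⟩).mpr hX.irr, hr0, localHyp_of_oddDiscr W Wd p hpd hmult hadd,
    hram⟩

end Supply

end Summit.BirchSwinnertonDyer.Rank1Residual.AdditivePotMult

end
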